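import Mathlib
import Summits.Ventures.HodgeRepro.Tier4.Target
import Summits.Ventures.HodgeRepro.Tier4.Line3.WittRank3

/-!
# Tier4/Line3/WittSymm — Witt's theorem for the SYMMETRIC rank-2 quadruple `(a, b, a, b)` (rung for L3.4 / L3.5)

Blind re-derivation cell `pub-hodge-repro`, Tier 4 «PROVE THE STEP» (README §9–§10), LINE L3 (orbit expansion of the
quadruple theta period; skeleton `Tier4/Line3/Skeleton.lean` v0.9 S12190), seat t4-L2-p3 on L3.5 `term_dominated`
(lead S12234).

THE LEMMA (a rung of L3.4 / L3.5, named in their docstrings as «Witt for the symmetric tuple: `witt_rank3`'s argument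
on the rank-2 block»): in the anisotropic hermitian 3-space `V = E³` (form `⟨u, v⟩_H = c(u)ᵀ H v` = `hform c H u v` of
`Tier4/Target.lean`, `H` `c`-hermitian, `c` an involution), a quadruple `x` whose Gram matrix equals that of the
symmetric quadruple `xm = (a, b, a, b)` with `a, b` linearly independent lies in the `U(H)(E)`-orbit of `xm`:
`x = g • xm` for some `g` with `c(g)ᵀ H g = H`.  Consequently (L3.4 / L3.5) an off-main line tuple of the depth-`N`
ball has a Gram entry DIFFERENT from the main one — the input of the archimedean-size rung R5 (`Majorant.lean`).

PROOF (self-contained linear algebra on top of the landed `witt_rank3_of_gram`, L3.b, t4-L3-p1):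
* `x₂ = x₀` and `x₃ = x₁`: `⟨x₀ − x₂, x₀ − x₂⟩ = ⟨a,a⟩ − ⟨a,a⟩ − ⟨a,a⟩ + ⟨a,a⟩ = 0`, so `x₀ = x₂` by anisotropy.
* a non-zero `n ⊥ a, b` and a non-zero `n' ⊥ x₀, x₁` exist (the kernel of `v ↦ (⟨a,v⟩, ⟨b,v⟩) : E³ → E²` is
  non-trivial); `⟨n,n⟩ ≠ 0 ≠ ⟨n',n'⟩` by anisotropy, and `(a, b, n)`, `(x₀, x₁, n')` are bases.
* discriminants: for the matrix `B` with columns `(a, b, n)`, `det(c(B)ᵀ H B) = c(det B) · det H · det B` and, the Gram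
  matrix being block diagonal, `= D · ⟨n,n⟩` with `D = ⟨a,a⟩⟨b,b⟩ − ⟨a,b⟩⟨b,a⟩`; likewise `D · ⟨n',n'⟩ = c(det B') det H
  det B'` for the columns `(x₀, x₁, n')` (same `D`, the Gram matrices agree).  Hence `D ≠ 0` and, with
  `μ := det B / det B'`, `⟨μ n', μ n'⟩ = c(μ) μ ⟨n',n'⟩ = ⟨n,n⟩` — the two orthogonal lines are isometric.
* `witt_rank3_of_gram` on the quadruples `(a, b, n, b)` and `(x₀, x₁, μ n', x₁)` (bases in front, all 16 Gram entries
  equal) gives `g ∈ U(H)` with `x₀ = g a`, `x₁ = g b`; with the first step, `x = g • (a, b, a, b)`.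

PRINTED FORM: Witt's theorem for hermitian spaces (Mœglin–Vignéras–Waldspurger, LNM 1291, chap. 1 §I.9; row
I-t4-lit-6-20) — the case proved here needs only the rank-3 case landed as L3.b plus the isometry of the two
orthogonal lines, which is the discriminant computation above; no literature fact is assumed.

Module contract: imports Mathlib, `Tier4/Target.lean` and `Tier4/Line3/WittRank3.lean` only (by name); every
declaration carries a docstring; `#print axioms witt_symm_of_gram` = `[propext, Classical.choice, Quot.sound]`.
Nothing here asserts anything about the truth of (P); HC_CM is NOT proved by anyone in this repository.
-/

set_option autoImplicit false

noncomputable section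

namespace Summit.Ventures.HodgeRepro.Tier4.Line3

open Matrix

section WittSymm

variable {E : Type*} [Field E] (c : E ≃+* E) (H : Matrix (Fin 3) (Fin 3) E)

/-! ### Sesquilinearity of `hform` -/

/-- `⟨x + y, z⟩_H = ⟨x, z⟩_H + ⟨y, z⟩_H`. -/
theorem hform_add_left (x y z : Fin 3 → E) : hform c H (x + y) z = hform c H x z + hform c H y z := by
  unfold hform
  have h : (fun i => c ((x + y) i)) = (fun i => c (x i)) + fun i => c (y i) := by
    funext i
    simp [map_add]
  rw [h, add_dotProduct]

/-- `⟨x − y, z⟩_H = ⟨x, z⟩_H − ⟨y, z⟩_H`. -/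
theorem hform_sub_left (x y z : Fin 3 → E) : hform c H (x - y) z = hform c H x z - hform c H y z := by
  unfold hform
  have h : (fun i => c ((x - y) i)) = (fun i => c (x i)) - fun i => c (y i) := by
    funext i
    simp [map_sub]
  rw [h, sub_dotProduct]

/-- `⟨x, y + z⟩_H = ⟨x, y⟩_H + ⟨x, z⟩_H`. -/
theorem hform_add_right (x y z : Fin 3 → E) : hform c H x (y + z) = hform c H x y + hform c H x z := by
  unfold hform
  rw [Matrix.mulVec_add, dotProduct_add]

/-- `⟨x, y − z⟩_H = ⟨x, y⟩_H − ⟨x, z⟩_H`. -/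
theorem hform_sub_right (x y z : Fin 3 → E) : hform c H x (y - z) = hform c H x y - hform c H x z := by
  unfold hform
  rw [Matrix.mulVec_sub, dotProduct_sub]

/-- `⟨t • x, y⟩_H = c(t) · ⟨x, y⟩_H` (conjugate-linear in the first slot). -/
theorem hform_smul_left (t : E) (x y : Fin 3 → E) : hform c H (t • x) y = c t * hform c H x y := by
  unfold hform
  have h : (fun i => c ((t • x) i)) = c t • fun i => c (x i) := by
    funext i
    simp [map_mul]
  rw [h, smul_dotProduct, smul_eq_mul]

/-- `⟨x, t • y⟩_H = t · ⟨x, y⟩_H` (linear in the second slot). -/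
theorem hform_smul_right (t : E) (x y : Fin 3 → E) : hform c H x (t • y) = t * hform c H x y := by
  unfold hform
  rw [Matrix.mulVec_smul, dotProduct_smul, smul_eq_mul]

/-- `⟨0, y⟩_H = 0`. -/
theorem hform_zero_left (y : Fin 3 → E) : hform c H 0 y = 0 := by
  unfold hform
  have h : (fun i => c ((0 : Fin 3 → E) i)) = (0 : Fin 3 → E) := by
    funext i
    simp
  rw [h, zero_dotProduct]

/-- `⟨x, 0⟩_H = 0`. -/
theorem hform_zero_right (x : Fin 3 → E) : hform c H x 0 = 0 := by
  unfold hform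
  rw [Matrix.mulVec_zero, dotProduct_zero]

/-- Hermitian symmetry `⟨y, x⟩_H = c ⟨x, y⟩_H` for a `c`-hermitian `H` and an involution `c`. -/
theorem hform_symm (hHerm : IsCHermitian c H) (hc : ∀ t, c (c t) = t) (x y : Fin 3 → E) :
    hform c H y x = c (hform c H x y) := by
  have hH : ∀ i j, c (H i j) = H j i := fun i j => by
    have h := congrFun (congrFun hHerm j) i
    rw [cstar_apply] at h
    exact h
  simp only [hform, dotProduct, Matrix.mulVec, Fin.sum_univ_three, map_add, map_mul, hc, hH]
  ring

/-! ### Orthogonal complements and bases -/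

/-- A non-zero vector orthogonal (on the right) to two given vectors exists in `E³`. -/
theorem exists_orth (a b : Fin 3 → E) :
    ∃ n : Fin 3 → E, n ≠ 0 ∧ hform c H a n = 0 ∧ hform c H b n = 0 := by
  let φ : (Fin 3 → E) →ₗ[E] (Fin 2 → E) :=
    { toFun := fun v => ![hform c H a v, hform c H b v]
      map_add' := by
        intro v w
        funext k
        fin_cases k <;> simp [hform_add_right]
      map_smul' := by
        intro t v
        funext k
        fin_cases k <;> simp [hform_smul_right] }
  have hker : LinearMap.ker φ ≠ ⊥ := LinearMap.ker_ne_bot_of_finrank_lt (by simp)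
  obtain ⟨n, hn, hn0⟩ := (Submodule.ne_bot_iff _).mp hker
  refine ⟨n, hn0, ?_, ?_⟩
  · have h := congrFun (LinearMap.mem_ker.mp hn) 0
    simpa [φ] using h
  · have h := congrFun (LinearMap.mem_ker.mp hn) 1
    simpa [φ] using h

/-- Two vectors whose `2×2` Gram determinant `⟨u,u⟩⟨v,v⟩ − ⟨u,v⟩⟨v,u⟩` is non-zero are linearly independent. -/
theorem linearIndependent_pair_of_gram (u v : Fin 3 → E)
    (hD : hform c H u u * hform c H v v - hform c H u v * hform c H v u ≠ 0) :
    LinearIndependent E ![u, v] := by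
  rw [LinearIndependent.pair_iff]
  intro s t hst
  have h1 := congrArg (fun w => hform c H u w) hst
  have h2 := congrArg (fun w => hform c H v w) hst
  simp only [hform_add_right, hform_smul_right, hform_zero_right] at h1 h2
  constructor
  · have h : s * (hform c H u u * hform c H v v - hform c H u v * hform c H v u) = 0 := by
      linear_combination (hform c H v v) * h1 - (hform c H u v) * h2
    exact (mul_eq_zero.mp h).resolve_right hD
  · have h : t * (hform c H u u * hform c H v v - hform c H u v * hform c H v u) = 0 := by
      linear_combination (hform c H u u) * h2 - (hform c H v u) * h1
    exact (mul_eq_zero.mp h).resolve_right hD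

/-- Adjoining a vector `n` with `⟨u,n⟩ = ⟨v,n⟩ = 0` and `⟨n,n⟩ ≠ 0` to an independent pair `u, v` gives a basis. -/
theorem linearIndependent_triple_of_orth (u v n : Fin 3 → E) (huv : LinearIndependent E ![u, v])
    (hun : hform c H u n = 0) (hvn : hform c H v n = 0) (hnn : hform c H n n ≠ 0) :
    LinearIndependent E ![u, v, n] := by
  rw [Fintype.linearIndependent_iff]
  intro g hg
  have hsum : g 0 • u + g 1 • v + g 2 • n = 0 := by
    simpa [Fin.sum_univ_three] using hg
  have h2 : g 2 = 0 := by
    have h := congrArg (fun w => hform c H w n) hsum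
    simp only [hform_add_left, hform_smul_left, hun, hvn, hform_zero_left, mul_zero, zero_add] at h
    have h' : c (g 2) = 0 := (mul_eq_zero.mp h).resolve_right hnn
    exact (map_eq_zero c).mp h'
  have h01 : g 0 • u + g 1 • v = 0 := by
    rw [h2, zero_smul, add_zero] at hsum
    exact hsum
  obtain ⟨h0, h1⟩ := LinearIndependent.pair_iff.mp huv _ _ h01
  intro i
  fin_cases i
  · exact h0
  · exact h1
  · exact h2

/-! ### Discriminants -/

/-- `det (c(B)ᵀ H B) = c(det B) · det H · det B`. -/
theorem det_cstar_mul_mul (B : Matrix (Fin 3) (Fin 3) E) :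
    (cstar c B * H * B).det = c B.det * H.det * B.det := by
  rw [Matrix.det_mul, Matrix.det_mul]
  congr 1
  congr 1
  unfold cstar
  rw [Matrix.det_transpose, RingEquiv.map_det, RingEquiv.mapMatrix_apply]

/-- The Gram determinant of a basis `(u, v, n)` with `n` orthogonal to `u, v` on both sides is
`(⟨u,u⟩⟨v,v⟩ − ⟨u,v⟩⟨v,u⟩) · ⟨n,n⟩`. -/
theorem det_gram_of_orth (u v n : Fin 3 → E) (hun : hform c H u n = 0) (hvn : hform c H v n = 0)
    (hnu : hform c H n u = 0) (hnv : hform c H n v = 0) :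
    (cstar c (Matrix.of fun k i => (![u, v, n] i) k) * H * Matrix.of fun k i => (![u, v, n] i) k).det =
      (hform c H u u * hform c H v v - hform c H u v * hform c H v u) * hform c H n n := by
  rw [Matrix.det_fin_three]
  simp only [cstar_mul_mul_apply, Matrix.of_apply]
  simp [hun, hvn, hnu, hnv]
  ring

/-! ### Witt for the symmetric quadruple -/

/-- **WITT FOR THE SYMMETRIC RANK-2 QUADRUPLE.** If `a, b` are linearly independent and the Gram matrix of `x`
equals that of `(a, b, a, b)`, then `x = g • (a, b, a, b)` for some `g ∈ U(H)`. -/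
theorem witt_symm_of_gram (hAn : Anisotropic c H) (hHerm : IsCHermitian c H) (hc : ∀ t, c (c t) = t)
    (a b : Fin 3 → E) (hab : LinearIndependent E ![a, b]) (x : Fin 4 → Fin 3 → E)
    (hG : ∀ i j, hform c H (x i) (x j) = hform c H (![a, b, a, b] i) (![a, b, a, b] j)) :
    ∃ g : Matrix (Fin 3) (Fin 3) E, IsUnitaryOf c H g ∧ ∀ j, x j = g *ᵥ ![a, b, a, b] j := by
  -- the Gram entries of `x` against those of `(a, b, a, b)`
  have h00 : hform c H (x 0) (x 0) = hform c H a a := by simpa using hG 0 0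
  have h01 : hform c H (x 0) (x 1) = hform c H a b := by simpa using hG 0 1
  have h10 : hform c H (x 1) (x 0) = hform c H b a := by simpa using hG 1 0
  have h11 : hform c H (x 1) (x 1) = hform c H b b := by simpa using hG 1 1
  have h02 : hform c H (x 0) (x 2) = hform c H a a := by simpa using hG 0 2
  have h20 : hform c H (x 2) (x 0) = hform c H a a := by simpa using hG 2 0
  have h22 : hform c H (x 2) (x 2) = hform c H a a := by simpa using hG 2 2
  have h13 : hform c H (x 1) (x 3) = hform c H b b := by simpa using hG 1 3
  have h31 : hform c H (x 3) (x 1) = hform c H b b := by simpa using hG 3 1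
  have h33 : hform c H (x 3) (x 3) = hform c H b b := by simpa using hG 3 3
  -- step 1: `x 2 = x 0`, `x 3 = x 1`
  have hx2 : x 2 = x 0 := by
    have h : hform c H (x 0 - x 2) (x 0 - x 2) = 0 := by
      rw [hform_sub_left, hform_sub_right, hform_sub_right, h00, h02, h20, h22]
      ring
    exact (sub_eq_zero.mp (hAn _ h)).symm
  have hx3 : x 3 = x 1 := by
    have h : hform c H (x 1 - x 3) (x 1 - x 3) = 0 := by
      rw [hform_sub_left, hform_sub_right, hform_sub_right, h11, h13, h31, h33]
      ring
    exact (sub_eq_zero.mp (hAn _ h)).symm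
  -- step 2: orthogonal complements
  obtain ⟨n, hn0, han, hbn⟩ := exists_orth c H a b
  obtain ⟨n', hn'0, hxn', hyn'⟩ := exists_orth c H (x 0) (x 1)
  have hnn : hform c H n n ≠ 0 := fun h => hn0 (hAn n h)
  have hn'n' : hform c H n' n' ≠ 0 := fun h => hn'0 (hAn n' h)
  have hna : hform c H n a = 0 := by rw [hform_symm c H hHerm hc, han, map_zero]
  have hnb : hform c H n b = 0 := by rw [hform_symm c H hHerm hc, hbn, map_zero]
  have hn'x : hform c H n' (x 0) = 0 := by rw [hform_symm c H hHerm hc, hxn', map_zero]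
  have hn'y : hform c H n' (x 1) = 0 := by rw [hform_symm c H hHerm hc, hyn', map_zero]
  -- step 3: the bases `(a, b, n)` and `(x 0, x 1, n')`, their matrices and determinants
  have hdetH : H.det ≠ 0 := ((Matrix.isUnit_iff_isUnit_det H).mp (isUnit_of_anisotropic c H hAn)).ne_zero
  have hB3 : LinearIndependent E ![a, b, n] := linearIndependent_triple_of_orth c H a b n hab han hbn hnn
  set B : Matrix (Fin 3) (Fin 3) E := Matrix.of fun k i => (![a, b, n] i) k with hBdef
  have hBu : IsUnit B := Matrix.linearIndependent_cols_iff_isUnit.mp hB3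
  have hBd : B.det ≠ 0 := ((Matrix.isUnit_iff_isUnit_det B).mp hBu).ne_zero
  set D : E := hform c H a a * hform c H b b - hform c H a b * hform c H b a with hDdef
  have hblk : (cstar c B * H * B).det = D * hform c H n n :=
    det_gram_of_orth c H a b n han hbn hna hnb
  have hdet : (cstar c B * H * B).det = c B.det * H.det * B.det := det_cstar_mul_mul c H B
  have hD : D ≠ 0 := by
    intro hD0
    have h := hdet
    rw [hblk, hD0, zero_mul] at h
    have hcB : c B.det ≠ 0 := (map_ne_zero c).mpr hBd
    exact (mul_ne_zero (mul_ne_zero hcB hdetH) hBd) h.symm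
  have hx01 : LinearIndependent E ![x 0, x 1] := by
    apply linearIndependent_pair_of_gram c H
    rw [h00, h01, h10, h11]
    exact hD
  have hB3' : LinearIndependent E ![x 0, x 1, n'] :=
    linearIndependent_triple_of_orth c H (x 0) (x 1) n' hx01 hxn' hyn' hn'n'
  set B' : Matrix (Fin 3) (Fin 3) E := Matrix.of fun k i => (![x 0, x 1, n'] i) k with hB'def
  have hB'u : IsUnit B' := Matrix.linearIndependent_cols_iff_isUnit.mp hB3'
  have hB'd : B'.det ≠ 0 := ((Matrix.isUnit_iff_isUnit_det B').mp hB'u).ne_zero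
  have hblk' : (cstar c B' * H * B').det = D * hform c H n' n' := by
    rw [det_gram_of_orth c H (x 0) (x 1) n' hxn' hyn' hn'x hn'y, h00, h01, h10, h11]
  have hdet' : (cstar c B' * H * B').det = c B'.det * H.det * B'.det := det_cstar_mul_mul c H B'
  -- step 4: the isometry of the orthogonal lines: `μ := det B / det B'`
  set μ : E := B.det / B'.det with hμdef
  have hμ : hform c H (μ • n') (μ • n') = hform c H n n := by
    rw [hform_smul_left, hform_smul_right, hμdef, map_div₀]
    have e1 : hform c H n n = c B.det * H.det * B.det / D := by
      rw [← hdet, hblk]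
      field_simp
    have e2 : hform c H n' n' = c B'.det * H.det * B'.det / D := by
      rw [← hdet', hblk']
      field_simp
    rw [e1, e2]
    have hcB' : c B'.det ≠ 0 := (map_ne_zero c).mpr hB'd
    field_simp
  -- step 5: Witt for the rank-3 quadruples `(a, b, n, b)` and `(x 0, x 1, μ n', x 1)`
  have hx' : LinearIndependent E (fun j : Fin 3 => ![x 0, x 1, μ • n', x 1] (Fin.castSucc j)) := by
    have hμ0 : μ ≠ 0 := div_ne_zero hBd hB'd
    have h : (fun j : Fin 3 => ![x 0, x 1, μ • n', x 1] (Fin.castSucc j)) = ![x 0, x 1, μ • n'] := by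
      funext j
      fin_cases j <;> rfl
    rw [h]
    apply linearIndependent_triple_of_orth c H (x 0) (x 1) (μ • n') hx01
    · rw [hform_smul_right, hxn', mul_zero]
    · rw [hform_smul_right, hyn', mul_zero]
    · rw [hμ]
      exact hnn
  have hx : LinearIndependent E (fun j : Fin 3 => ![a, b, n, b] (Fin.castSucc j)) := by
    have h : (fun j : Fin 3 => ![a, b, n, b] (Fin.castSucc j)) = ![a, b, n] := by
      funext j
      fin_cases j <;> rfl
    rw [h]
    exact hB3
  have hG4 : ∀ i j, hform c H (![a, b, n, b] i) (![a, b, n, b] j) =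
      hform c H (![x 0, x 1, μ • n', x 1] i) (![x 0, x 1, μ • n', x 1] j) := by
    intro i j
    fin_cases i <;> fin_cases j <;>
      simp [hform_smul_left, hform_smul_right, han, hbn, hna, hnb, hxn', hyn', hn'x, hn'y, h00, h01, h10, h11,
        hμ]
  obtain ⟨g, hg, hgx⟩ := witt_rank3_of_gram c H hAn ![a, b, n, b] ![x 0, x 1, μ • n', x 1] hx hx' hG4
  refine ⟨g, hg, fun j => ?_⟩
  have hg0 : x 0 = g *ᵥ a := by simpa using hgx 0
  have hg1 : x 1 = g *ᵥ b := by simpa using hgx 1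
  fin_cases j
  · exact hg0
  · exact hg1
  · simpa [hx2] using hg0
  · simpa [hx3] using hg1

end WittSymm

end Summit.Ventures.HodgeRepro.Tier4.Line3

end
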